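import Mathlib
import Literature.Probability.LatticeModels.LatticeGraph
import Summits.CriticalPhenomena.Ising3DConformalLimit.Theorems.GaussianScaleMixtureCriticalTwoPointGSMGsmClosureOfTight

/-!
# Cube representation of pointwise limits of probability-GSM kernels on `ℤ³`

Pure measure theory (push-forward + Prokhorov on a compact set + portmanteau), used by line
`Sketch` of the crux `CriticalTwoPointGSM` (stmt-CriticalPhenomena-8365). If kernels
`G n : ℤ³ → ℝ` are Gaussian scale mixtures `G n x = ∫ exp(-∑ᵢ sᵢ xᵢ²) dνₙ(s)` with probability
mixing measures `νₙ` carried by the closed octant `{s | ∀ i, 0 ≤ sᵢ}` and `G n → Glim` pointwise on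
`ℤ³`, then `Glim` has a CUBE REPRESENTATION: a probability measure `μ` on `ℝ³` carried by the
closed cube `[0,1]³` with `Glim x = ∫ ∏ᵢ tᵢ^{xᵢ²} dμ(t)` (natural-number powers, `0⁰ = 1`).

No tightness is assumed. In cube coordinates `tᵢ = e^{-sᵢ} ∈ (0,1]` the kernel `exp(-∑ sᵢxᵢ²)` is
the polynomial kernel `∏ tᵢ^{xᵢ²}`; the push-forwards `μₙ` of the `νₙ` under `s ↦ (e^{-sᵢ})ᵢ` live
on the compact cube, so the family `{μₙ}` is tight for free; Prokhorov's theorem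
(`MeasureTheory.isCompact_closure_of_isTightMeasureSet`) and Lévy–Prokhorov metrisability of
`ProbabilityMeasure (Fin 3 → ℝ)` give a weakly convergent subsequence `μ_{φ n} → μ`; the open
complement `{t | ∃ i, tᵢ < 0 ∨ 1 < tᵢ}` of the cube is `μ`-null by the portmanteau inequality
`μ U ≤ liminf μ_{φ n} U = 0`; and the integrals converge because on the cube the polynomial kernel
agrees with the bounded continuous clamped kernel `∏ (max 0 (min tᵢ 1))^{xᵢ²} ∈ [0,1]`, against
which weak convergence can be tested. (Same pattern as the tight-case closure theorem
`gsmClosure_of_tight`, whose lemma `CriticalTwoPointGSMClosure.ae_nonneg_of_octant` is reused.)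
-/

namespace Summit.CriticalPhenomena.Ising3DConformalLimit.Theorems

open MeasureTheory Filter Topology
open Literature.Probability.LatticeModels
open scoped BigOperators

namespace CriticalTwoPointGSMCube

/-- The coordinatewise exponential map `s ↦ (e^{-sᵢ})ᵢ` (octant → cube) is continuous. -/
theorem continuous_expMap : Continuous fun s : Fin 3 → ℝ => fun i => Real.exp (-(s i)) := by
  fun_prop

/-- The complement of the closed cube, `{t | ∃ i, tᵢ < 0 ∨ 1 < tᵢ}`, is open. -/
theorem isOpen_offCube : IsOpen {t : Fin 3 → ℝ | ∃ i, t i < 0 ∨ 1 < t i} := by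
  have : {t : Fin 3 → ℝ | ∃ i, t i < 0 ∨ 1 < t i} = ⋃ i, ({t | t i < 0} ∪ {t | 1 < t i}) := by
    ext t; simp
  rw [this]
  exact isOpen_iUnion fun i => (isOpen_lt (continuous_apply i) continuous_const).union
    (isOpen_lt continuous_const (continuous_apply i))

/-- The exponential map sends the closed octant into the closed cube: the preimage of the
complement of the cube lies in the complement `{s | ∃ i, sᵢ < 0}` of the octant. -/
theorem preimage_offCube_subset :
    (fun s : Fin 3 → ℝ => fun i => Real.exp (-(s i))) ⁻¹' {t | ∃ i, t i < 0 ∨ 1 < t i} ⊆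
      {s | ∃ i, s i < 0} := by
  rintro s ⟨i, hi⟩
  refine ⟨i, ?_⟩
  rcases hi with h | h
  · exact absurd h (not_lt.2 (Real.exp_pos _).le)
  · have h' : (0 : ℝ) < -(s i) := by
      rw [← Real.exp_lt_exp, Real.exp_zero]; exact h
    linarith

/-- A measure giving no mass to the complement of the closed cube is carried by the cube:
almost every point has all coordinates in `[0,1]`. -/
theorem ae_mem_cube {μ : Measure (Fin 3 → ℝ)} (h : μ {t | ∃ i, t i < 0 ∨ 1 < t i} = 0) :
    ∀ᵐ t ∂μ, ∀ i, 0 ≤ t i ∧ t i ≤ 1 := by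
  rw [ae_iff]
  have : {t : Fin 3 → ℝ | ¬∀ i, 0 ≤ t i ∧ t i ≤ 1} = {t | ∃ i, t i < 0 ∨ 1 < t i} := by
    ext t
    simp only [Set.mem_setOf_eq, not_forall, not_and_or, not_le]
  rw [this]; exact h

/-- The clamped polynomial kernel `t ↦ ∏ᵢ (max 0 (min tᵢ 1))^{|xᵢ|²}` is continuous. -/
theorem continuous_clampKernel (x : Site 3) :
    Continuous fun t : Fin 3 → ℝ => ∏ i, (max 0 (min (t i) 1)) ^ ((x i).natAbs ^ 2) := by
  fun_prop

/-- The clamped polynomial kernel takes values of norm at most `1`. -/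
theorem norm_clampKernel_le_one (x : Site 3) (t : Fin 3 → ℝ) :
    ‖∏ i, (max 0 (min (t i) 1)) ^ ((x i).natAbs ^ 2)‖ ≤ 1 := by
  have h0 : ∀ i, 0 ≤ max 0 (min (t i) 1) := fun i => le_max_left _ _
  have h1 : ∀ i, max 0 (min (t i) 1) ≤ 1 := fun i => max_le zero_le_one (min_le_right _ _)
  rw [Real.norm_eq_abs, abs_of_nonneg (Finset.prod_nonneg fun i _ => pow_nonneg (h0 i) _)]
  exact Finset.prod_le_one (fun i _ => pow_nonneg (h0 i) _) fun i _ => pow_le_one₀ (h0 i) (h1 i)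

/-- On a measure carried by the closed cube, the clamped kernel and the polynomial kernel
`t ↦ ∏ᵢ tᵢ^{|xᵢ|²}` have the same integral. -/
theorem integral_clampKernel_eq {μ : Measure (Fin 3 → ℝ)}
    (h : μ {t | ∃ i, t i < 0 ∨ 1 < t i} = 0) (x : Site 3) :
    ∫ t, ∏ i, (max 0 (min (t i) 1)) ^ ((x i).natAbs ^ 2) ∂μ =
      ∫ t, ∏ i, (t i) ^ ((x i).natAbs ^ 2) ∂μ := by
  refine integral_congr_ae ?_
  filter_upwards [ae_mem_cube h] with t ht
  refine Finset.prod_congr rfl fun i _ => ?_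
  rw [min_eq_left (ht i).2, max_eq_right (ht i).1]

/-- In cube coordinates the Gaussian kernel is the polynomial kernel:
`∏ᵢ (e^{-sᵢ})^{|xᵢ|²} = exp(-∑ᵢ sᵢ xᵢ²)`. -/
theorem prod_exp_pow_eq (s : Fin 3 → ℝ) (x : Site 3) :
    ∏ i, Real.exp (-(s i)) ^ ((x i).natAbs ^ 2) = Real.exp (-∑ i, s i * ((x i : ℝ)) ^ 2) := by
  rw [← Finset.sum_neg_distrib, Real.exp_sum]
  refine Finset.prod_congr rfl fun i _ => ?_
  rw [← Real.exp_nat_mul]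
  congr 1
  have : (((x i).natAbs : ℕ) : ℝ) ^ 2 = ((x i : ℝ)) ^ 2 := by
    rw [Nat.cast_natAbs, Int.cast_abs, sq_abs]
  push_cast
  rw [this]
  ring

/-- Against the push-forward of a measure on the closed octant under the exponential map, the
clamped kernel integrates to the Gaussian scale mixture `∫ exp(-∑ sᵢxᵢ²) dν`. -/
theorem integral_clampKernel_map {ν : Measure (Fin 3 → ℝ)} (hoct : ν {s | ∃ i, s i < 0} = 0)
    (x : Site 3) :
    ∫ t, ∏ i, (max 0 (min (t i) 1)) ^ ((x i).natAbs ^ 2)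
        ∂(ν.map fun s : Fin 3 → ℝ => fun i => Real.exp (-(s i))) =
      ∫ s, Real.exp (-∑ i, s i * ((x i : ℝ)) ^ 2) ∂ν := by
  rw [integral_map continuous_expMap.measurable.aemeasurable
    (continuous_clampKernel x).aestronglyMeasurable]
  refine integral_congr_ae ?_
  filter_upwards [CriticalTwoPointGSMClosure.ae_nonneg_of_octant hoct] with s hs
  rw [← prod_exp_pow_eq]
  refine Finset.prod_congr rfl fun i _ => ?_
  have h1 : Real.exp (-(s i)) ≤ 1 := Real.exp_le_one_iff.2 (by linarith [hs i])
  rw [min_eq_left h1, max_eq_right (Real.exp_pos _).le]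

end CriticalTwoPointGSMCube

open CriticalTwoPointGSMCube in
/-- **Cube representation of pointwise limits of probability-GSM kernels on `ℤ³`.** If kernels
`G n` on `ℤ³` are represented by probability measures `ν n` on the closed octant,
`G n x = ∫ exp(-∑ᵢ sᵢ xᵢ²) dνₙ(s)`, and `G n → Glim` pointwise, then `Glim` has a cube
representation: a probability measure `μ` on `ℝ³` carried by the closed cube `[0,1]³` with
`Glim x = ∫ ∏ᵢ tᵢ^{xᵢ²} dμ(t)` (faces `tᵢ = 0` allowed; `0⁰ = 1`). No tightness hypothesis:
push forward along `s ↦ (e^{-sᵢ})ᵢ` to the compact cube, where Prokhorov is free; portmanteau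
for the open complement of the cube; weak convergence tested on the bounded continuous clamped
kernels `∏ (max 0 (min tᵢ 1))^{xᵢ²}`, which agree with the kernel where all the measures live. -/
theorem cubeRep_of_approximants (G : ℕ → Site 3 → ℝ) (Glim : Site 3 → ℝ)
    (ν : ℕ → Measure (Fin 3 → ℝ))
    (hP : ∀ n, IsProbabilityMeasure (ν n)) (hoct : ∀ n, (ν n) {s | ∃ i, s i < 0} = 0)
    (hrep : ∀ n (x : Site 3), G n x = ∫ s, Real.exp (-∑ i, s i * ((x i : ℝ)) ^ 2) ∂(ν n))
    (hlim : ∀ x : Site 3, Tendsto (fun n => G n x) atTop (𝓝 (Glim x))) :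
    ∃ μ : Measure (Fin 3 → ℝ), IsProbabilityMeasure μ ∧ μ {t | ∃ i, t i < 0 ∨ 1 < t i} = 0 ∧
      ∀ x : Site 3, Glim x = ∫ t, ∏ i, (t i) ^ ((x i).natAbs ^ 2) ∂μ := by
  -- Step 1: push the mixing measures forward to the cube along `E s = (e^{-sᵢ})ᵢ`.
  let E : (Fin 3 → ℝ) → (Fin 3 → ℝ) := fun s i => Real.exp (-(s i))
  have hE : Measurable E := continuous_expMap.measurable
  let ρ : ℕ → Measure (Fin 3 → ℝ) := fun n => (ν n).map E
  have hρP : ∀ n, IsProbabilityMeasure (ρ n) := fun n => by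
    haveI := hP n
    exact Measure.isProbabilityMeasure_map hE.aemeasurable
  have hρcube : ∀ n, ρ n {t | ∃ i, t i < 0 ∨ 1 < t i} = 0 := by
    intro n
    show (ν n).map E {t | ∃ i, t i < 0 ∨ 1 < t i} = 0
    rw [Measure.map_apply hE isOpen_offCube.measurableSet]
    exact measure_mono_null preimage_offCube_subset (hoct n)
  -- Step 2: package as probability measures; tight for free since the cube is compact.
  let P : ℕ → ProbabilityMeasure (Fin 3 → ℝ) := fun n => ⟨ρ n, hρP n⟩
  have htight : IsTightMeasureSet
      {((Q : ProbabilityMeasure (Fin 3 → ℝ)) : Measure (Fin 3 → ℝ)) | Q ∈ Set.range P} := by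
    rw [isTightMeasureSet_iff_exists_isCompact_measure_compl_le]
    intro ε _
    refine ⟨Set.pi Set.univ fun _ => Set.Icc (0 : ℝ) 1, isCompact_univ_pi fun _ => isCompact_Icc,
      ?_⟩
    rintro _ ⟨Q, ⟨n, rfl⟩, rfl⟩
    have hsub : (Set.pi Set.univ fun _ : Fin 3 => Set.Icc (0 : ℝ) 1)ᶜ ⊆
        {t | ∃ i, t i < 0 ∨ 1 < t i} := by
      intro t ht
      simpa only [Set.mem_compl_iff, Set.mem_univ_pi, Set.mem_Icc, not_forall, not_and_or,
        not_le, Set.mem_setOf_eq] using ht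
    have h0 : (ρ n) (Set.pi Set.univ fun _ : Fin 3 => Set.Icc (0 : ℝ) 1)ᶜ = 0 :=
      measure_mono_null hsub (hρcube n)
    show (ρ n) _ ≤ ε
    rw [h0]; exact bot_le
  -- Step 3: Prokhorov + Lévy–Prokhorov metrisability: a weakly convergent subsequence.
  obtain ⟨μ, -, φ, hφ, hμ⟩ := (isCompact_closure_of_isTightMeasureSet htight).tendsto_subseq
    (x := P) fun n => subset_closure (Set.mem_range_self n)
  -- Step 4: the limit is carried by the closed cube (portmanteau for the open complement).
  have hcubeμ : (μ : Measure (Fin 3 → ℝ)) {t | ∃ i, t i < 0 ∨ 1 < t i} = 0 := by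
    have h := ProbabilityMeasure.le_liminf_measure_open_of_tendsto hμ isOpen_offCube
    have h0 : (fun n => ((P ∘ φ) n : Measure (Fin 3 → ℝ)) {t | ∃ i, t i < 0 ∨ 1 < t i}) =
        fun _ => 0 := by
      funext n
      exact hρcube (φ n)
    rw [h0, liminf_const] at h
    exact le_antisymm h bot_le
  refine ⟨μ, inferInstance, hcubeμ, fun x => ?_⟩
  -- Step 5: test weak convergence on the bounded continuous clamped kernel.
  let f : BoundedContinuousFunction (Fin 3 → ℝ) ℝ :=
    BoundedContinuousFunction.ofNormedAddCommGroup
      (fun t : Fin 3 → ℝ => ∏ i, (max 0 (min (t i) 1)) ^ ((x i).natAbs ^ 2))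
      (continuous_clampKernel x) 1 (norm_clampKernel_le_one x)
  have hf := (ProbabilityMeasure.tendsto_iff_forall_integral_tendsto.1 hμ) f
  have h1 : (fun n => ∫ t, f t ∂((P ∘ φ) n : Measure (Fin 3 → ℝ))) = fun n => G (φ n) x := by
    funext n
    rw [hrep]
    exact integral_clampKernel_map (hoct (φ n)) x
  have h2 : ∫ t, f t ∂(μ : Measure (Fin 3 → ℝ)) =
      ∫ t, ∏ i, (t i) ^ ((x i).natAbs ^ 2) ∂(μ : Measure (Fin 3 → ℝ)) :=
    integral_clampKernel_eq hcubeμ x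
  rw [h1, h2] at hf
  exact tendsto_nhds_unique ((hlim x).comp hφ.tendsto_atTop) hf

end Summit.CriticalPhenomena.Ising3DConformalLimit.Theorems
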